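import Summits.Ventures.HodgeRepro.BallLemmaWCover

/-!
# Lemma W at `p = 2` with its CONGRUENCE finite cover (seat p5)

Blind re-derivation cell `pub-hodge-repro`, seat `p5`.  The `p = 2` (sealed-ball) analogue of
`CongruenceHermitianLevel.lean`: ROUTE.md A4 says «`Γ″ := Γ′ ∩ g⁻¹Γ′g` (congruence, finite index)»;
`BallLemmaWCover.lemmaW_finiteCover` delivers the finite index, this file adds the congruence LEVEL —
`Γ″` contains the principal congruence subgroup `Γ(N² M)` for a denominator `N ≠ 0` of the `K`-rational
Hecke element `g` (`BallCongruence.congr_le_conjSub` + `BallCongruenceNF.exists_denominator`).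

* `exists_congr_le_inf_conjSub_numberField` — for `Γ(M) ≤ Γ′`, `M ≠ 0`, and `K`-rational `g`:
  `∃ L ≠ 0, Γ(L) ≤ Γ′ ⊓ g⁻¹ Γ′ g`;
* **`lemmaW_congruenceCover`** — `lemmaW_finiteCover` with the congruence clause: some `K`-rational `g` has
  `(g^*F) ∧ G ≢ 0`, invariant under `Γ″ = Γ′ ⊓ g⁻¹ Γ′ g`, `Γ(L) ≤ Γ″` for some `L ≠ 0`, and `Γ″` of finite
  index in `Γ′`;
* `lemmaW_congruenceCover_holo` — the same for analytic fields, with the open dense `Γ″`-stable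
  non-vanishing set of `lemmaW_finiteCover_holo`.

Nothing here says anything about the status of the Hodge conjecture for CM abelian varieties.
-/

set_option autoImplicit false

noncomputable section

namespace Summit.Ventures.HodgeRepro

namespace BallCover

open Matrix hiding J
open NumberField
open BallModel BallInv BallCong BallHolo
open HodgeRepro.BallGen.RealApprox (arithSubgroup)

variable {K : Type} [Field K] [NumberField K] [IsCMField K]

omit [IsCMField K] in
/-- **`Γ′ ⊓ g⁻¹ Γ′ g` is a congruence subgroup** for a `K`-rational `g ∈ U(2,1)`: for `Γ(M) ≤ Γ′`, `M ≠ 0`,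
it contains `Γ(N² M)` where `N ≠ 0` is a common denominator of `g` and `g⁻¹`. -/
theorem exists_congr_le_inf_conjSub_numberField (φ₀ : K →+* ℂ) {Γ' : Subgroup U21} {M : 𝓞 K}
    (hM0 : M ≠ 0) (hM : congr (φ𝓞 K φ₀) (φ𝓞_injective K φ₀) M ≤ Γ') {g : U21}
    (hg : IsKRational K φ₀ g) :
    ∃ L : 𝓞 K, L ≠ 0 ∧ congr (φ𝓞 K φ₀) (φ𝓞_injective K φ₀) L ≤ Γ' ⊓ conjSub g Γ' := by
  obtain ⟨N, hN, A, B, hA, hB⟩ := exists_denominator K φ₀ hg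
  exact ⟨N ^ 2 * M, mul_ne_zero (pow_ne_zero 2 hN) hM0,
    le_inf ((congr_le_congr_of_dvd _ _ (Dvd.intro_left _ rfl)).trans hM)
      ((congr_le_conjSub _ _ g N M A B hA hB).trans (conjSub_mono g hM))⟩

/-- **Lemma W at `p = 2` with its CONGRUENCE finite cover (ROUTE.md A4, both clauses of «`Γ″` (congruence,
finite index)»), for every CM field.**  Let `φ₀ : K ↪ ℂ` be a CM field, `Γ(M) ≤ Γ′ ≤ U(2,1)(𝓞_K)` with
`M ≠ 0`, and `F, G` continuous `Γ′`-invariant cotangent fields on the ball, not identically zero.  Then some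
`K`-rational `g ∈ U(2,1)(K)` has: `(g^*F) ∧ G ≢ 0`; it is invariant under `Γ″ = Γ′ ⊓ g⁻¹ Γ′ g`; `Γ″`
contains a principal congruence subgroup `Γ(L)`, `L ≠ 0`; and `Γ″` has finite index in `Γ′`. -/
theorem lemmaW_congruenceCover (φ₀ : K →+* ℂ) {Γ' : Subgroup U21} (hΓ : Γ' ≤ arith (φ𝓞 K φ₀)) {M : 𝓞 K}
    (hM0 : M ≠ 0) (hM : congr (φ𝓞 K φ₀) (φ𝓞_injective K φ₀) M ≤ Γ') {F G : Ball → Fin 2 → ℂ}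
    (hF : Continuous F) (hG : Continuous G) (hF0 : F ≠ 0) (hG0 : G ≠ 0) (hFΓ : IsInvariant Γ' F)
    (hGΓ : IsInvariant Γ' G) :
    ∃ g ∈ arithSubgroup φ₀, wedgeForm (pull g F) G ≠ 0 ∧
      IsInvariantTop (Γ' ⊓ conjSub g Γ') (wedgeForm (pull g F) G) ∧
      (∃ L : 𝓞 K, L ≠ 0 ∧ congr (φ𝓞 K φ₀) (φ𝓞_injective K φ₀) L ≤ Γ' ⊓ conjSub g Γ') ∧
      (Γ' ⊓ conjSub g Γ').IsFiniteRelIndex Γ' := by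
  obtain ⟨g, hg, hne, hinv, hfin⟩ := lemmaW_finiteCover φ₀ hΓ hM0 hM hF hG hF0 hG0 hFΓ hGΓ
  exact ⟨g, hg, hne, hinv,
    exists_congr_le_inf_conjSub_numberField φ₀ hM0 hM (isKRational_of_mem_arithSubgroup φ₀ hg), hfin⟩

/-- **Holomorphic form with the congruence clause.**  For analytic `F, G` on the ball, not identically
zero, with `Γ′`-invariant restrictions, some `K`-rational `g` has: the non-vanishing set of `(g^*F) ∧ G` is
open, dense and `Γ″`-stable; `(g^*F) ∧ G` is `Γ″`-invariant; `Γ(L) ≤ Γ″` for some `L ≠ 0`; and `Γ″` has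
finite index in `Γ′`. -/
theorem lemmaW_congruenceCover_holo (φ₀ : K →+* ℂ) {Γ' : Subgroup U21} (hΓ : Γ' ≤ arith (φ𝓞 K φ₀))
    {M : 𝓞 K} (hM0 : M ≠ 0) (hM : congr (φ𝓞 K φ₀) (φ𝓞_injective K φ₀) M ≤ Γ')
    {F G : (Fin 2 → ℂ) → (Fin 2 → ℂ)} (hF : AnalyticOnNhd ℂ F ballSet) (hG : AnalyticOnNhd ℂ G ballSet)
    (hF0 : ∃ w : Ball, F w.1 ≠ 0) (hG0 : ∃ z : Ball, G z.1 ≠ 0)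
    (hFΓ : IsInvariant Γ' fun z : Ball => F z.1) (hGΓ : IsInvariant Γ' fun z : Ball => G z.1) :
    ∃ g ∈ arithSubgroup φ₀,
      IsOpen {z : Ball | wedgeForm (pull g fun z : Ball => F z.1) (fun z : Ball => G z.1) z ≠ 0} ∧
      Dense {z : Ball | wedgeForm (pull g fun z : Ball => F z.1) (fun z : Ball => G z.1) z ≠ 0} ∧
      (∀ δ ∈ Γ' ⊓ conjSub g Γ', ∀ z : Ball,
        wedgeForm (pull g fun z : Ball => F z.1) (fun z : Ball => G z.1) z ≠ 0 →
          wedgeForm (pull g fun z : Ball => F z.1) (fun z : Ball => G z.1) (act δ z) ≠ 0) ∧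
      IsInvariantTop (Γ' ⊓ conjSub g Γ') (wedgeForm (pull g fun z : Ball => F z.1) fun z : Ball => G z.1) ∧
      (∃ L : 𝓞 K, L ≠ 0 ∧ congr (φ𝓞 K φ₀) (φ𝓞_injective K φ₀) L ≤ Γ' ⊓ conjSub g Γ') ∧
      (Γ' ⊓ conjSub g Γ').IsFiniteRelIndex Γ' := by
  obtain ⟨g, hg, hopen, hdense, hstable, hinv, hfin⟩ :=
    lemmaW_finiteCover_holo φ₀ hΓ hM0 hM hF hG hF0 hG0 hFΓ hGΓ
  exact ⟨g, hg, hopen, hdense, hstable, hinv,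
    exists_congr_le_inf_conjSub_numberField φ₀ hM0 hM (isKRational_of_mem_arithSubgroup φ₀ hg), hfin⟩

end BallCover

end Summit.Ventures.HodgeRepro

end
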